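import Summits.MatrixMultiplication.OmegaCensus.DominoZ5Z5Cover19Defs
import Summits.MatrixMultiplication.OmegaCensus.DominoZ5Z5Data19S5
import HarnessLib

/-!
# Soundness of the line-certificate table for `(1,9,12)@325`, hole class `σ = 5`, part A (directions `0`, `1`)

ω-census `pub-omega`, family (b3), seat pub-omega-group gen 38.  Framing: lottery ticket; floor = certified bounds/negative ranges.
VALUE: kernel computation of the `ℤ₅²` stage of the census cell `(1,9,12)@325` of `ℤ₅ × ℤ₆₅` (design `HOME/pub-omega-group-g37/DESIGN-1-9-12.md`);
NOT progress on ω.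
`soundChk3 5 9 tree19s5 (certAt19 5)` ranges over `6 × 715` (direction, count vector) pairs, each unflagged one looked up linearly in the
`3 415`-entry certificate tables (`table19`, `exrow19`); as ONE `decide + kernel` it exceeds the kernel memory cap (probe, this seat), so it is
computed in `12` pieces (direction × half of `compsLB [] 5 9`), three files of two directions per hole class, and reassembled in part C.
This part also carries the two generic chunking lemmas `all_of_take_drop`, `soundChk3_of_dirs`.
-/

namespace Summit.MatrixMultiplication.OmegaCensus

namespace Z5Z5ThreeSet

open ZpZpDomino

/-! ## Chunking lemmas for `soundChk3` (generic) -/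

/-- `List.all` from its `take`/`drop` halves. [folklore] -/
theorem all_of_take_drop {α : Type*} (l : List α) (f : α → Bool) (n : ℕ) (h1 : (l.take n).all f = true)
    (h2 : (l.drop n).all f = true) : l.all f = true := by
  rw [← List.take_append_drop n l, List.all_append, h1, h2]; rfl

/-- `soundChk3` from its per-direction checks. [folklore] -/
theorem soundChk3_of_dirs (p d : ℕ) (tree : BTree) (cert : ℕ → List ℕ → Bool)
    (h : ∀ j < p + 1, ((compsLB [] p d).all fun c => tree.mem (off p (d + 1) j + polyBE (d + 1) c) || cert j c) = true) :
    soundChk3 p d tree cert = true := by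
  unfold soundChk3
  rw [List.all_eq_true]
  intro j hj
  exact h j (List.mem_range.1 hj)

set_option maxRecDepth 100000 in
set_option maxHeartbeats 4000000 in
/-- Soundness piece: direction `0`, first half of the count vectors. [folklore] -/
theorem sound19s5_d0a : (((compsLB [] 5 9).take 358).all fun c =>
    tree19s5.mem (off 5 10 0 + polyBE 10 c) || certAt19 5 0 c) = true := by decide +kernel

set_option maxRecDepth 100000 in
set_option maxHeartbeats 4000000 in
/-- Soundness piece: direction `0`, second half of the count vectors. [folklore] -/
theorem sound19s5_d0b : (((compsLB [] 5 9).drop 358).all fun c =>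
    tree19s5.mem (off 5 10 0 + polyBE 10 c) || certAt19 5 0 c) = true := by decide +kernel

set_option maxRecDepth 100000 in
set_option maxHeartbeats 4000000 in
/-- Soundness piece: direction `1`, first half of the count vectors. [folklore] -/
theorem sound19s5_d1a : (((compsLB [] 5 9).take 358).all fun c =>
    tree19s5.mem (off 5 10 1 + polyBE 10 c) || certAt19 5 1 c) = true := by decide +kernel

set_option maxRecDepth 100000 in
set_option maxHeartbeats 4000000 in
/-- Soundness piece: direction `1`, second half of the count vectors. [folklore] -/
theorem sound19s5_d1b : (((compsLB [] 5 9).drop 358).all fun c =>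
    tree19s5.mem (off 5 10 1 + polyBE 10 c) || certAt19 5 1 c) = true := by decide +kernel

end Z5Z5ThreeSet

end Summit.MatrixMultiplication.OmegaCensus
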